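import Literature.Topology.FourManifolds.SmallSetComplementSimplyConnected

/-!
# Null-homotopies can be pushed off a closed set of codimension `≥ 3`: the relative form of
# `isSimplyConnected_diff_of_smallSet`

Topic `Literature/Topology/FourManifolds` (infrastructure for the fact seat
`provefact-Literature.Geometry.Riemannian.LawsonMichelsohn1984_surrounding`: Wall's form of the
trading of `1`-handles needs *injectivity* of `π₁(V₂₊) → π₁(W)` where Milnor's Thm. 8.1 uses
`π₁(V₂₊) = π₁(W) = 1`; this file generalises the general-position leaf of
`SmallSetComplementSimplyConnected.lean` accordingly).  Everything here is **proved**.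

`SmallSetComplementSimplyConnected.lean` proves: for `U` open and **simply connected** in a
`C¹` manifold and `S ⊆ U` relatively closed, made of interior points, covered by countably
many `C¹` images of codimension `≥ 3`, the complement `U ∖ S` is simply connected (Milnor
1965, Remark 1 after Thm. 6.4: *"this uses `λ ≥ 2`, `n - λ ≥ 3`"*).  Its proof contracts a loop
of `U ∖ S` inside `U` and then pushes the contraction off `S` by the kernel half of van
Kampen's theorem over finitely many good chart balls.  Keeping the first step as a hypothesis
gives the relative statement needed for fundamental-group injectivity:

* `homotopicWithin_refl_diff_of_smallSet` — for `U` open and **path connected**, `S` as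
  above: a loop of `U ∖ S` which is null-homotopic within `U` is null-homotopic within
  `U ∖ S`.  In other words `π₁(U ∖ S) → π₁(U)` has trivial kernel (at every base point).

(The simply connected statement of the tree follows by taking the null-homotopy within `U`
from simple connectivity.)

## References

* J. Milnor, *Lectures on the h-cobordism theorem* (1965), Remark 1 after Thm. 6.4 (PDF
  p. 38). [MilnorHCobordism1965]
* A. Hatcher, *Algebraic Topology* (2002), §1.2, Thm. 1.20 (van Kampen). [HatcherAT2002]
-/

open scoped Manifold Topology unitInterval
open Set Function Filter Metric Module
open Literature.AlgebraicTopology.FundamentalGroup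

noncomputable section

namespace Literature.Topology.FourManifolds

universe u

section Manifold

variable {E : Type*} [NormedAddCommGroup E] [NormedSpace ℝ E] [FiniteDimensional ℝ E]
  {H : Type*} [TopologicalSpace H] {J : ModelWithCorners ℝ E H}
  {M : Type u} [TopologicalSpace M] [ChartedSpace H M] [IsManifold J 1 M]
  {P : Type*} [NormedAddCommGroup P] [NormedSpace ℝ P] [FiniteDimensional ℝ P]

/-- **A null-homotopy can be pushed off a closed set of codimension `≥ 3`** (general position;
Milnor 1965, Remark 1 after Thm. 6.4).  Let `M` be a `C¹` manifold with corners, `U ⊆ M`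
open and path connected, `S ⊆ U` relatively closed in `U`, consisting of interior points and
covered by countably many `C¹` images of open subsets of `P`, `dim P + 3 ≤ dim E`.  Then a loop
of `U ∖ S` which contracts within `U` contracts within `U ∖ S`: the kernel of
`π₁(U ∖ S) → π₁(U)` is trivial.  Proof: the contraction runs through a compact set `K`;
finitely many good chart balls `B₁, …, Bₘ` (`exists_chartBall`) cover `S ∩ K`, and descending
along `Y_j = U ∖ (S ∖ (B₁ ∪ ⋯ ∪ B_j))` with the kernel half of van Kampen's theorem
(`homotopicWithin_refl_of_union`) the loop contracts in `Y₀ = U ∖ S` — the proof of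
`isSimplyConnected_diff_of_smallSet` with its first step turned into a hypothesis.
[cite: MilnorHCobordism1965, Remark 1 after Thm. 6.4 (PDF p. 38)] -/
theorem homotopicWithin_refl_diff_of_smallSet (hdim : finrank ℝ P + 3 ≤ finrank ℝ E)
    {ι : Type*} [Countable ι] (g : ι → P → M) (O : ι → Set P) (hO : ∀ i, IsOpen (O i))
    (hg : ∀ i, ContMDiffOn 𝓘(ℝ, P) J 1 (g i) (O i)) {U S : Set M} (hU : IsOpen U)
    (hSU : S ⊆ U) (hScl : closure S ∩ U ⊆ S) (hSint : ∀ x ∈ S, J.IsInteriorPoint x)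
    (hS : S ⊆ ⋃ i, g i '' O i) (hUpc : IsPathConnected U) {x : M} (p : Path x x)
    (hp : ∀ t, p t ∈ U \ S) (hpU : VanKampen.HomotopicWithin U p (Path.refl x)) :
    VanKampen.HomotopicWithin (U \ S) p (Path.refl x) := by
  classical
  -- the contraction of `p` in `U`
  obtain ⟨F₀, hF₀⟩ := hpU
  set K : Set M := range F₀ with hK
  have hKc : IsCompact K := isCompact_range F₀.continuous
  have hKU : K ⊆ U := by rintro _ ⟨q, rfl⟩; exact hF₀ q
  -- the compact set `S ∩ K`
  set SK : Set M := K ∩ closure S with hSK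
  have hSKc : IsCompact SK := hKc.inter_right isClosed_closure
  have hSKS : SK ⊆ S := fun z hz => hScl ⟨hz.2, hKU hz.1⟩
  -- good balls about the points of `S`, and a finite subcover of `S ∩ K`
  have hballs : ∀ y : ↥SK, ∃ B : Set M, IsOpen B ∧ (y : M) ∈ B ∧ B ⊆ U ∧
      ∀ S' : Set M, S' ⊆ ⋃ i, g i '' O i → closure S' ∩ U ⊆ S' →
        (B \ S').Nonempty ∧ IsPathConnected (B \ S') ∧
          ∀ z (δ : Path z z), (∀ t, δ t ∈ B \ S') →
            VanKampen.HomotopicWithin (B \ S') δ (Path.refl z) := fun y =>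
    exists_chartBall hdim g O hO hg hU (hSU (hSKS y.2)) (hSint _ (hSKS y.2))
  choose B hBo hyB hBU hB using hballs
  obtain ⟨t₀, ht₀⟩ := hSKc.elim_finite_subcover B hBo fun y hy => mem_iUnion.2 ⟨⟨y, hy⟩, hyB _⟩
  -- the sets `S ∖ ⋃_{i ∈ t} B i` are again small and relatively closed
  have hsmall : ∀ t : Finset ↥SK, (S \ ⋃ i ∈ t, B i) ⊆ ⋃ i, g i '' O i := fun t =>
    sdiff_subset.trans hS
  have hrel : ∀ t : Finset ↥SK, closure (S \ ⋃ i ∈ t, B i) ∩ U ⊆ S \ ⋃ i ∈ t, B i := by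
    intro t z hz
    refine ⟨hScl ⟨closure_mono sdiff_subset hz.1, hz.2⟩, fun hzB => ?_⟩
    obtain ⟨i, hi, hzi⟩ := mem_iUnion₂.1 hzB
    have hnhds : B i ∈ 𝓝 z := (hBo i).mem_nhds hzi
    obtain ⟨w, hwB, hw⟩ := mem_closure_iff_nhds.1 hz.1 (B i) hnhds
    exact hw.2 (mem_iUnion₂.2 ⟨i, hi, hwB⟩)
  -- descending induction over the finite subcover
  suffices hind : ∀ t : Finset ↥SK,
      VanKampen.HomotopicWithin (U \ (S \ ⋃ i ∈ t, B i)) p (Path.refl x) →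
        VanKampen.HomotopicWithin (U \ S) p (Path.refl x) by
    refine hind t₀ ⟨F₀, fun q => ⟨hF₀ q, fun hq => hq.2 ?_⟩⟩
    exact ht₀ ⟨mem_range_self q, subset_closure hq.1⟩
  intro t
  induction t using Finset.induction_on with
  | empty => intro h; simpa using h
  | insert i t hit ih =>
    intro h
    apply ih
    -- the van Kampen step: `A = U ∖ (S ∖ ⋃_t B)`, `A ∪ B i = U ∖ (S ∖ ⋃_{insert i t} B)`
    set S' : Set M := S \ ⋃ j ∈ t, B j with hS'
    set A : Set M := U \ S' with hA
    have hAo : IsOpen A := isOpen_diff_of_closure_inter_subset hU (hrel t)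
    have hApc : IsPathConnected A :=
      isPathConnected_diff_of_smallSet hdim g O hO hg hU hUpc (hrel t)
        (fun z hz => hSint z hz.1) (hsmall t)
    have hAB : A ∩ B i = B i \ S' := by
      ext z
      simp only [hA, mem_inter_iff, Set.mem_sdiff]
      constructor
      · rintro ⟨⟨-, hzS'⟩, hzB⟩; exact ⟨hzB, hzS'⟩
      · rintro ⟨hzB, hzS'⟩; exact ⟨⟨hBU i hzB, hzS'⟩, hzB⟩
    obtain ⟨-, hBpc, hBloop⟩ := hB i S' (hsmall t) (hrel t)
    have hmeet : IsPathConnected (A ∩ B i) := by rw [hAB]; exact hBpc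
    have hloop : ∀ y (δ : Path y y), (∀ s, δ s ∈ A ∩ B i) →
        VanKampen.HomotopicWithin A δ (Path.refl y) := by
      intro y δ hδ
      rw [hAB] at hδ
      obtain ⟨G, hG⟩ := hBloop y δ hδ
      exact ⟨G, fun q => by rw [← hAB] at hG; exact (hG q).1⟩
    have hunion : A ∪ B i = U \ (S \ ⋃ j ∈ insert i t, B j) := by
      ext z
      simp only [hA, hS', Finset.set_biUnion_insert, mem_union, Set.mem_sdiff, mem_iUnion,
        not_and, not_exists, exists_prop, not_forall, not_not]
      constructor
      · rintro (⟨hzU, hz⟩ | hzB)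
        · exact ⟨hzU, fun hzS => Or.inr (by simpa using hz hzS)⟩
        · exact ⟨hBU i hzB, fun _ => Or.inl hzB⟩
      · rintro ⟨hzU, hz⟩
        by_cases hzB : z ∈ B i
        · exact Or.inr hzB
        · refine Or.inl ⟨hzU, fun hzS => ?_⟩
          rcases hz hzS with h' | h'
          · exact absurd h' hzB
          · simpa using h'
    have hpA : ∀ s, p s ∈ A := fun s => ⟨(hp s).1, fun h' => (hp s).2 h'.1⟩
    rw [← hunion] at h
    exact homotopicWithin_refl_of_union hAo (hBo i) hApc hmeet hloop p hpA h

end Manifold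

end Literature.Topology.FourManifolds

end
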